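import Summits.Ventures.CertifiedManyBodySolver.Downfold.EmeryBoxesHg1223IPC1TrueCornerBand
import Summits.Ventures.CertifiedManyBodySolver.Downfold.EmeryBoxesHg1223IPC2TrueCornerBand
import Summits.Ventures.CertifiedManyBodySolver.Downfold.EmeryBoxesHg1223IPC3TrueCornerBand
import HarnessLib

/-!
# THE ONE-BAND FERMI-SURFACE SHAPE `t′/t` OF THE WHOLE TYPED 3BE BOX `emeryBoxHg1223IP (EmeryBoxesTrilayer)` OVER ITS WHOLE FILLING BAND AT ITS TWO TRUE CORNERS — hull of 3 t_pp′-PIECES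
# (true-corner rule, band form, §B.87 (j); router/EMERY-SHAPE-CORNERS.tsv «true band» rows)

Venture CertifiedManyBodySolver, cell `pub/hubbard-downfold` (stage S1; INFLATION-RULES-3to1-B §B.87 (j)), seat hubbard-downfold-mod-4 (technique B, g35); namespace
`Summit.Ventures.CertifiedManyBodySolver.Downfold.Emery`. Everything PROVED (0 sorry). WHAT THIS IS NOT: a statement about HgBa₂Ca₂Cu₃O₈ INNER plane (typed companion) — SCREENING-GRADE box; `U = 0`
one-body kinematics of the σ model (rigid band). For every row of `[1.23, 2.02] × [1.16, 1.44] × [0.6, 0.76] × [0.11, 0.22]` eV and every `ν ∈ [2/5, 43/100]`: t′/t ∈ **[-0.3566, -0.2474]** =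
hull of the piece band windows [0.11, 0.145]: [-0.3388, -0.2474] ∪ [0.145, 0.185]: [-0.3484, -0.2567] ∪ [0.185, 0.22]: [-0.3566, -0.2671] (`EmeryBoxesHg1223IPC<i>TrueCornerBand`), a case split on t_pp′.

Sources: three-band model [HybertsenSchluterChristensen1989, Eq. (1)]; [AndersenEtAl1995, §6]; box rows as cited in the typed object's file.
-/

noncomputable section

namespace Summit.Ventures.CertifiedManyBodySolver.Downfold.Emery

open Real Set

/-- **filling band ν ∈ [2/5, 43/100]: for every row of the box and every filling of the band the one-band Fermi-surface `t′/t` (object E) lies in `[-0.3566, -0.2474]` — between its values at the two TRUE corners** (hull of the 3 t_pp′-pieces' band windows). [folklore] -/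
theorem hg1223IPBox_fsRatio_true_band {Δ a b c ν : ℝ} (hΔ : Δ ∈ Icc ((123 : ℝ) / 100) ((101 : ℝ) / 50)) (ha : a ∈ Icc ((29 : ℝ) / 25) ((36 : ℝ) / 25)) (hb : b ∈ Icc ((3 : ℝ) / 5) ((19 : ℝ) / 25)) (hc : c ∈ Icc ((11 : ℝ) / 100) ((11 : ℝ) / 50)) (hν : ν ∈ Icc ((2 : ℝ) / 5) ((43 : ℝ) / 100)) :
    fsRatio Δ a b c (fermiEnergyOf Δ a b c ν) ∈ Icc ((-1783 : ℝ) / 5000) ((-1237 : ℝ) / 5000) := by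
  obtain ⟨hc1, hc2⟩ := hc
  rcases le_total c ((29 : ℝ) / 200) with hcut1 | hcut1
  · have h := hg1223IPC1Box_fsRatio_true_band hΔ ha hb ⟨hc1, hcut1⟩ hν
    exact ⟨le_trans (by norm_num) h.1, le_trans h.2 (by norm_num)⟩
  · rcases le_total c ((37 : ℝ) / 200) with hcut2 | hcut2
    · have h := hg1223IPC2Box_fsRatio_true_band hΔ ha hb ⟨hcut1, hcut2⟩ hν
      exact ⟨le_trans (by norm_num) h.1, le_trans h.2 (by norm_num)⟩
    · have h := hg1223IPC3Box_fsRatio_true_band hΔ ha hb ⟨hcut2, hc2⟩ hν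
      exact ⟨le_trans (by norm_num) h.1, le_trans h.2 (by norm_num)⟩

end Summit.Ventures.CertifiedManyBodySolver.Downfold.Emery
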